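import Summits.Ventures.PercRepro.S1CFCapsSmall

/-!
# PercRepro — COUNTING TOOLS FOR THE ν = 4 CAPS, AND «MANY PARALLEL PAIRS KILL THE SHORT CIRCUITS» (p1, gen 37)

Counting inputs of the caps `D₃`, `Q₄²`, `D₄` of p7's ν = 4 program:
* **`ncard_inter_eq_le`** — the `k`-subsets of `E` meeting `F ⊆ E` in exactly `i` points number at most
  `C(|F|, i) · C(|E ∖ F|, k − i)` (the injection `X ↦ (X ∩ F, X ∖ F)`);
* **`ncard_supersets_le`** — the `k`-subsets of `E` containing a fixed `P` number at most `C(|E ∖ P|, k − |P|)`;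
* **`ncard_with_dep_pair_le`** — the `k`-subsets of `E` containing a dependent pair number at most
  `C(|E| − 2, k − 2) · D₂` (a finset union bound over the dependent pairs);
* **`isCircuit_of_dep_three_of_no_dep_pair`** — a dependent `3`-set with no dependent pair is a circuit (loopless);
* **`not_isCircuit_of_four_le_ncard_dep_pairs`** (LEMMA K): in the loopless coloop-free matroid of nullity `4` on `12`
  points, if there are `≥ 4` dependent pairs then there is NO circuit of size `3` or `4`. The set `U` of points with a
  parallel partner has nullity `≥ 3` (by the relative circuit count, `≤ 3` pairs live in a set of nullity `≤ 2`), hence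
  exactly `3` (`U ≠ E`: `E` is not covered by parallel pairs) and `|U| ≤ 6` (`2 · rk U ≤ |U|`); a short circuit `C ⊄ U`
  raises the nullity of `U ∪ C` (`≤ 10` points) to `4`; a short circuit `C ⊆ U` together with one partner of each of its
  points is a set of `2|C|` points inside `cl C` (rank `|C| − 1`), of nullity `|C| + 1 ≥ 4`.
Nothing about any cell is claimed. Axioms: standard.
-/

open scoped Matroid

namespace PercRepro

namespace S1CF

open Set

variable {α : Type}

/-- The `k`-subsets of `E` meeting `F ⊆ E` in exactly `i` points number at most `C(|F|, i) · C(|E ∖ F|, k − i)`. -/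
theorem ncard_inter_eq_le {E F : Set α} (hE : E.Finite) (hF : F ⊆ E) (k i : ℕ) :
    {X : Set α | X ⊆ E ∧ X.ncard = k ∧ (X ∩ F).ncard = i}.ncard ≤
      F.ncard.choose i * (E \ F).ncard.choose (k - i) := by
  classical
  have hFfin : F.Finite := hE.subset hF
  have hEFfin : (E \ F).Finite := hE.subset sdiff_subset
  have hmap : ∀ X ∈ {X : Set α | X ⊆ E ∧ X.ncard = k ∧ (X ∩ F).ncard = i},
      (fun X : Set α => (X ∩ F, X \ F)) X ∈
        ({Y : Set α | Y ⊆ F ∧ Y.ncard = i} ×ˢ {Z : Set α | Z ⊆ E \ F ∧ Z.ncard = k - i}) := by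
    intro X hX
    obtain ⟨hXE, hXk, hXi⟩ := hX
    refine ⟨⟨inter_subset_right, hXi⟩, ⟨sdiff_subset_sdiff_left hXE, ?_⟩⟩
    show (X \ F).ncard = k - i
    have := Set.ncard_inter_add_ncard_sdiff_eq_ncard X F (hE.subset hXE)
    omega
  have hinj : Set.InjOn (fun X : Set α => (X ∩ F, X \ F))
      {X : Set α | X ⊆ E ∧ X.ncard = k ∧ (X ∩ F).ncard = i} := by
    intro X _ X' _ h
    simp only [Prod.mk.injEq] at h
    rw [← Set.inter_union_sdiff X F, ← Set.inter_union_sdiff X' F, h.1, h.2]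
  calc {X : Set α | X ⊆ E ∧ X.ncard = k ∧ (X ∩ F).ncard = i}.ncard
      ≤ ({Y : Set α | Y ⊆ F ∧ Y.ncard = i} ×ˢ {Z : Set α | Z ⊆ E \ F ∧ Z.ncard = k - i}).ncard :=
        Set.ncard_le_ncard_of_injOn _ hmap hinj
          ((hFfin.finite_subsets.subset (fun Y hY => hY.1)).prod
            (hEFfin.finite_subsets.subset (fun Z hZ => hZ.1)))
    _ = F.ncard.choose i * (E \ F).ncard.choose (k - i) := by
        rw [Set.ncard_prod, ncard_subsets_eq_choose hFfin, ncard_subsets_eq_choose hEFfin]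

/-- The `k`-subsets of `E` containing a fixed `P ⊆ E` number at most `C(|E ∖ P|, k − |P|)`. -/
theorem ncard_supersets_le {E P : Set α} (hE : E.Finite) (k : ℕ) :
    {X : Set α | X ⊆ E ∧ X.ncard = k ∧ P ⊆ X}.ncard ≤ (E \ P).ncard.choose (k - P.ncard) := by
  classical
  have hEPfin : (E \ P).Finite := hE.subset sdiff_subset
  have hmap : ∀ X ∈ {X : Set α | X ⊆ E ∧ X.ncard = k ∧ P ⊆ X},
      (fun X : Set α => X \ P) X ∈ {Z : Set α | Z ⊆ E \ P ∧ Z.ncard = k - P.ncard} := by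
    intro X hX
    obtain ⟨hXE, hXk, hPX⟩ := hX
    refine ⟨sdiff_subset_sdiff_left hXE, ?_⟩
    show (X \ P).ncard = k - P.ncard
    have := Set.ncard_sdiff_add_ncard_of_subset hPX (hE.subset hXE)
    omega
  have hinj : Set.InjOn (fun X : Set α => X \ P) {X : Set α | X ⊆ E ∧ X.ncard = k ∧ P ⊆ X} := by
    intro X hX X' hX' h
    simp only at h
    rw [← Set.union_sdiff_cancel hX.2.2, ← Set.union_sdiff_cancel hX'.2.2, h]
  calc {X : Set α | X ⊆ E ∧ X.ncard = k ∧ P ⊆ X}.ncard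
      ≤ {Z : Set α | Z ⊆ E \ P ∧ Z.ncard = k - P.ncard}.ncard :=
        Set.ncard_le_ncard_of_injOn _ hmap hinj (hEPfin.finite_subsets.subset (fun Z hZ => hZ.1))
    _ = (E \ P).ncard.choose (k - P.ncard) := ncard_subsets_eq_choose hEPfin _

/-- **The `k`-subsets of `E` containing a dependent pair number at most `C(|E| − 2, k − 2) · D₂`.** -/
theorem ncard_with_dep_pair_le (M : Matroid α) [M.Finite] (k : ℕ) :
    {X : Set α | X ⊆ M.E ∧ X.ncard = k ∧ ∃ P ⊆ X, P.ncard = 2 ∧ M.Dep P}.ncard ≤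
      (M.E.ncard - 2).choose (k - 2) * {P : Set α | P ⊆ M.E ∧ P.ncard = 2 ∧ M.Dep P}.ncard := by
  classical
  have hEfin := M.ground_finite
  have h𝒟fin : {P : Set α | P ⊆ M.E ∧ P.ncard = 2 ∧ M.Dep P}.Finite :=
    hEfin.finite_subsets.subset (fun _ hP => hP.1)
  set D2f : Finset (Set α) := h𝒟fin.toFinset with hD2f
  have hTfin : ∀ P : Set α, {X : Set α | X ⊆ M.E ∧ X.ncard = k ∧ P ⊆ X}.Finite :=
    fun _ => hEfin.finite_subsets.subset (fun _ hX => hX.1)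
  set T : Set α → Finset (Set α) := fun P => (hTfin P).toFinset with hT
  have hsub : {X : Set α | X ⊆ M.E ∧ X.ncard = k ∧ ∃ P ⊆ X, P.ncard = 2 ∧ M.Dep P} ⊆
      ((D2f.biUnion T : Finset (Set α)) : Set (Set α)) := by
    intro X hX
    obtain ⟨hXE, hXk, P, hPX, hP2, hPdep⟩ := hX
    rw [Finset.coe_biUnion]
    refine Set.mem_iUnion₂.2 ⟨P, ?_, ?_⟩
    · rw [Finset.mem_coe, hD2f, Set.Finite.mem_toFinset]
      exact ⟨hPX.trans hXE, hP2, hPdep⟩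
    · rw [hT]
      simp only [Set.Finite.coe_toFinset, Set.mem_setOf_eq]
      exact ⟨hXE, hXk, hPX⟩
  have hbound : ∀ P ∈ D2f, (T P).card ≤ (M.E.ncard - 2).choose (k - 2) := by
    intro P hP
    rw [hD2f, Set.Finite.mem_toFinset] at hP
    obtain ⟨hPE, hP2, -⟩ := hP
    rw [hT]
    simp only
    rw [← Set.ncard_coe_finset, Set.Finite.coe_toFinset]
    have := ncard_supersets_le (P := P) hEfin k
    have hcard : (M.E \ P).ncard = M.E.ncard - 2 := by
      have := Set.ncard_sdiff_add_ncard_of_subset hPE hEfin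
      omega
    rw [hcard, hP2] at this
    exact this
  calc {X : Set α | X ⊆ M.E ∧ X.ncard = k ∧ ∃ P ⊆ X, P.ncard = 2 ∧ M.Dep P}.ncard
      ≤ ((D2f.biUnion T : Finset (Set α)) : Set (Set α)).ncard :=
        Set.ncard_le_ncard hsub (Finset.finite_toSet _)
    _ = (D2f.biUnion T).card := Set.ncard_coe_finset _
    _ ≤ D2f.card * (M.E.ncard - 2).choose (k - 2) := Finset.card_biUnion_le_card_mul _ _ _ hbound
    _ = (M.E.ncard - 2).choose (k - 2) * {P : Set α | P ⊆ M.E ∧ P.ncard = 2 ∧ M.Dep P}.ncard := by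
        rw [mul_comm, hD2f, ← Set.ncard_coe_finset, Set.Finite.coe_toFinset]

/-- A dependent `3`-set with no dependent pair is a circuit (loopless matroid). -/
theorem isCircuit_of_dep_three_of_no_dep_pair (M : Matroid α) [M.Finite] {X : Set α} (hX : X ⊆ M.E)
    (hX3 : X.ncard = 3) (hdep : M.Dep X) (hno : ∀ P ⊆ X, P.ncard = 2 → ¬ M.Dep P) : M.IsCircuit X := by
  rw [Matroid.isCircuit_iff_dep_forall_sdiff_singleton_indep]
  refine ⟨hdep, fun e he => ?_⟩
  have hXfin : X.Finite := M.ground_finite.subset hX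
  have h2 : (X \ {e}).ncard = 2 := by
    rw [Set.ncard_sdiff_singleton_of_mem he, hX3]
  have hsub : X \ {e} ⊆ M.E := sdiff_subset.trans hX
  rw [← Matroid.not_dep_iff hsub]
  exact hno _ sdiff_subset h2

/-- A circuit of size `≥ 3` contains no dependent pair. -/
theorem not_dep_pair_of_isCircuit (M : Matroid α) {C P : Set α} (hC : M.IsCircuit C) (hP : P ⊆ C)
    (hP2 : P.ncard = 2) (hC3 : 3 ≤ C.ncard) : ¬ M.Dep P := by
  intro hdep
  have hss : P ⊂ C := LE.le.ssubset_of_ne hP (fun h => by rw [h] at hP2; omega)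
  exact hdep.not_indep (hC.ssubset_indep hss)

/-- **LEMMA K**: with `≥ 4` dependent pairs there is no circuit of size `3` or `4`. -/
theorem not_isCircuit_of_four_le_ncard_dep_pairs (M : Matroid α) [M.Finite] (hL : ∀ e ∈ M.E, ¬ M.IsLoop e)
    (hK : ∀ e, ¬ M.IsColoop e) (hd : M.E.encard = M.eRank + ((4 : ℕ) : ℕ∞)) (hn : M.E.ncard = 12)
    (h4 : 4 ≤ {P : Set α | P ⊆ M.E ∧ P.ncard = 2 ∧ M.Dep P}.ncard) {C : Set α} (hC : M.IsCircuit C)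
    (hC3 : 3 ≤ C.ncard) (hC4 : C.ncard ≤ 4) : False := by
  classical
  have hEfin := M.ground_finite
  have hCE : C ⊆ M.E := hC.subset_ground
  have hCfin : C.Finite := hEfin.subset hCE
  -- the points with a partner
  set U := {u ∈ M.E | ∃ v ∈ M.E, v ≠ u ∧ M.Dep {u, v}} with hUdef
  have hUE : U ⊆ M.E := fun u hu => hu.1
  have hUfin : U.Finite := hEfin.subset hUE
  -- all dependent pairs are relative circuits of `U`
  have hpairs : {P : Set α | P ⊆ M.E ∧ P.ncard = 2 ∧ M.Dep P} ⊆
      {P : Set α | P ⊆ U ∧ P.ncard = 2 ∧ M.Dep (∅ ∪ P) ∧ ∀ Q, Q ⊂ P → M.Indep (∅ ∪ Q)} := by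
    intro P hP
    obtain ⟨hPE, hP2, hPdep⟩ := hP
    refine ⟨?_, hP2, by simpa using hPdep, fun Q hQ => by simpa using indep_of_ssubset_pair M hL hPE hP2 hQ⟩
    intro u huP
    refine ⟨hPE huP, ?_⟩
    obtain ⟨a, b, hab, rfl⟩ := Set.ncard_eq_two.1 hP2
    rcases huP with rfl | rfl
    · exact ⟨b, hPE (by simp), Ne.symm hab, hPdep⟩
    · exact ⟨a, hPE (by simp), hab, by rwa [Set.pair_comm]⟩
  -- nullity of `U` is `≥ 3`
  have hnull3 : (M.eRk U).toNat + 3 ≤ U.ncard := by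
    by_contra hlt
    push Not at hlt
    have hν : (∅ ∪ U).ncard ≤ (M.eRk (∅ ∪ U)).toNat + 2 := by simpa using (by omega : U.ncard ≤ (M.eRk U).toNat + 2)
    have := (Set.ncard_le_ncard hpairs (relCircuits_finite M ∅ hUE 2)).trans
      (ncard_relCircuits_le M 2 (by norm_num) 2 ∅ U (empty_subset _) hUE
        (Set.disjoint_left.2 fun a ha => absurd ha (Set.notMem_empty a)) M.empty_indep hν)
    norm_num at this
    omega
  -- `U` is covered by partners, so `U ≠ E` and `2 · rk U ≤ |U|`
  have hpartU : ∀ y ∈ U, ∃ z ∈ U, z ≠ y ∧ M.Dep {y, z} := by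
    intro y hy
    obtain ⟨v, hvE, hvy, hdep⟩ := hy.2
    exact ⟨v, ⟨hvE, y, hy.1, Ne.symm hvy, by rwa [Set.pair_comm]⟩, hvy, hdep⟩
  have hcover := two_mul_eRk_toNat_le_ncard_of_partner M hL U.ncard U hUE rfl hpartU
  have hUne : U ≠ M.E := by
    intro h
    rw [h, eRk_ground_toNat_eq_eight M hd hn, hn] at hcover
    omega
  have hUnull := ncard_add_one_le_eRk_toNat_add_of_ssubset M hd hK hUE hUne
  have hU6 : U.ncard ≤ 6 := by omega
  by_cases hCU : C ⊆ U
  · -- every point of `C` has a partner; the partners form an injective image outside `C` inside `cl C`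
    have hne : Nonempty α := ⟨Classical.choice (by
      have : C.Nonempty := by rw [← Set.ncard_pos hCfin]; omega
      exact ⟨this.some⟩)⟩
    have hpart : ∀ c ∈ C, ∃ v, v ∈ M.E ∧ v ≠ c ∧ M.Dep {c, v} := fun c hc => by
      obtain ⟨v, hvE, hvc, hdep⟩ := (hCU hc).2
      exact ⟨v, hvE, hvc, hdep⟩
    choose! p hp using hpart
    have hpC : ∀ c ∈ C, p c ∉ C := by
      intro c hc hpc
      obtain ⟨-, hne', hdep⟩ := hp c hc
      exact not_dep_pair_of_isCircuit M hC (by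
        intro w hw; rcases hw with rfl | rfl
        · exact hc
        · exact hpc) (Set.ncard_pair (Ne.symm hne')) hC3 hdep
    have hpcl : ∀ c ∈ C, p c ∈ M.closure C := by
      intro c hc
      obtain ⟨-, -, hdep⟩ := hp c hc
      have hcE : c ∈ M.E := hCE hc
      have := mem_closure_singleton_of_dep_pair M hcE (hL c hcE) hdep
      exact M.closure_subset_closure (Set.singleton_subset_iff.2 hc) this
    have hinj : Set.InjOn p C := by
      intro c hc c' hc' hpp
      by_contra hcc
      obtain ⟨hvE, -, hdep⟩ := hp c hc
      obtain ⟨-, -, hdep'⟩ := hp c' hc'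
      have hLv := hL (p c) hvE
      have h1 : c ∈ M.closure {p c} :=
        mem_closure_singleton_of_dep_pair M hvE hLv (by rwa [Set.pair_comm])
      have h2 : c' ∈ M.closure {p c} := by
        rw [hpp]
        exact mem_closure_singleton_of_dep_pair M (by rw [← hpp]; exact hvE) (by rw [← hpp]; exact hLv)
          (by rwa [Set.pair_comm])
      have hsub : ({c, c'} : Set α) ⊆ M.closure {p c} := by
        intro w hw; rcases hw with rfl | rfl
        · exact h1
        · exact h2
      have hr : M.eRk {c, c'} ≤ 1 := eRk_le_one_of_subset_closure_singleton M hsub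
      have hdep2 : M.Dep {c, c'} := by
        have hfin : ({c, c'} : Set α).Finite := Set.toFinite _
        rw [← Matroid.eRk_lt_encard_iff_dep_of_finite hfin (by
          intro w hw; rcases hw with rfl | rfl
          · exact hCE hc
          · exact hCE hc')]
        rw [Set.encard_pair hcc]
        exact lt_of_le_of_lt hr (by norm_num)
      exact not_dep_pair_of_isCircuit M hC (by
        intro w hw; rcases hw with rfl | rfl
        · exact hc
        · exact hc') (Set.ncard_pair hcc) hC3 hdep2
    set V := C ∪ p '' C with hVdef
    have hVcl : V ⊆ M.closure C := union_subset (M.subset_closure C hCE) (by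
      rintro _ ⟨c, hc, rfl⟩; exact hpcl c hc)
    have hVE : V ⊆ M.E := hVcl.trans (M.closure_subset_ground C)
    have hdisj : Disjoint C (p '' C) := by
      rw [Set.disjoint_left]
      rintro w hw ⟨c, hc, rfl⟩
      exact hpC c hc hw
    have hVcard : V.ncard = 2 * C.ncard := by
      rw [hVdef, Set.ncard_union_eq hdisj hCfin (hCfin.image p), hinj.ncard_image]; ring
    have hVrk : (M.eRk V).toNat + 1 ≤ C.ncard := by
      have h1 : M.eRk V ≤ M.eRk C := by
        calc M.eRk V ≤ M.eRk (M.closure C) := M.eRk_mono hVcl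
          _ = M.eRk C := M.eRk_closure_eq C
      have h2 := hC.eRk_add_one_eq
      rw [← S1.coe_toNat_eRk M hVE, ← S1.coe_toNat_eRk M hCE] at h1
      rw [← S1.coe_toNat_eRk M hCE, ← hCfin.cast_ncard_eq] at h2
      have h1' : (M.eRk V).toNat ≤ (M.eRk C).toNat := by exact_mod_cast h1
      have h2' : (M.eRk C).toNat + 1 = C.ncard := by exact_mod_cast h2
      omega
    have hVne : V ≠ M.E := by
      intro h; rw [h, hn] at hVcard; omega
    have := ncard_add_one_le_eRk_toNat_add_of_ssubset M hd hK hVE hVne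
    omega
  · -- `C ⊄ U`: the nullity of `U ∪ C` is `≥ 4` on `≤ 10` points
    have hstep := S1.nullity_step M hUE hC hCU
    have hUCE : U ∪ C ⊆ M.E := union_subset hUE hCE
    have hUCcard : (U ∪ C).ncard ≤ U.ncard + C.ncard := Set.ncard_union_le U C
    have hUCne : U ∪ C ≠ M.E := by
      intro h; rw [h, hn] at hUCcard; omega
    have := ncard_add_one_le_eRk_toNat_add_of_ssubset M hd hK hUCE hUCne
    omega

end S1CF

end PercRepro
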